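import Summits.ResolutionOfSingularities.ResolutionOfSingularities.Theorems.FrobeniusClosingSteerNoHeightOneCarrierTwoAlgebra
import HarnessLib

/-!
# Crux `Steer` (stmt-ResolutionOfSingularities-16345), chain W4.1, p = 2 σ-residual, HIGH half:
# B4 `noHeightOneCarrier_two` — no height-one carrier at a point step. II: permissibility of a regular carrier (α)
# and the reduction of B4 to the deep carrier (β)

OURS (campaign `res-hironaka`, rung L ★L-G4, slot W4.1; seat res-type-096 g8; object B4 of res-L0-w41-strat-2's §σ2.16
slate, dealt by res-L0-w41-plan-1 RULING 3, 2026-08-27T07:20:27Z; replaces the role of no printed item; NOT a statement of the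
manuscript under review; AI-produced, weaker than expert review). See part I
(`FrobeniusClosingSteerNoHeightOneCarrierTwoAlgebra.lean`) for the verbatim target and the division of labour. Here
(def-free, Theses-free; the skeleton's `IsSingPrime` / `IsTopSingComponent` / `IsPermissibleCentre` consumed UNFOLDED):

* `isRegularLocalRing_radicand_of_eq_bot` — the generic point is not singular when `f = s²` with `s ∉ Frac R` (`hirr`);
* `permissible_span_singleton_of_not_mem_sq` — **(α)**: for `u ∈ 𝔪 ∖ 𝔪²` with `(u)` singular and `f − g² ∈ (u)²`, the
  prime `(u)` satisfies `IsPermissibleCentre R 2 f (u)` UNFOLDED (singular; minimal — only `⊥` lies below and `⊥` is not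
  singular; top-dimensional — `dim R/(u) = 3 ≥ dim R/Q''` for every `Q'' ≠ ⊥`; `R/(u)` regular; equimultiple);
* `exists_deep_witness_of_singular_heightOne` — **B4 REDUCED TO (β)**: with no positive-dimensional σ_top-permissible
  centre (a point step), every singular height-one prime is `(u)` with `u ∈ 𝔪²` plus a local square root
  `d² f − a² ∈ (u)²`, `d ∉ (u)` — the input of the order-raising lemma of the sequel, which yields `f − ĝ² ∈ 𝔪⁴` so that
  B1 `divisorTrigger_two` contradicts the point step at stage `i + 1`.

[cite: Matsumura1987, Thm. 14.2] [folklore]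
-/

noncomputable section

-- `Summit.<S>.<S>.…` duplicates the summit name by design (single-problem summit).
set_option linter.dupNamespace false

open Polynomial IsLocalRing

namespace Summit.ResolutionOfSingularities.ResolutionOfSingularities.Theorems.SwitchingDichotomy

namespace NoHeightOneCarrier

open Literature.AlgebraicGeometry.Resolution

universe u

/-! ## (3) The generic point is not singular (`hirr`) -/

section Generic

variable {K : Type u} [Field K] [CharP K 2]

/-- **The generic point of the base is not a singular prime** when the radicand `f = s²` has NO square root in the
fraction field of the member (`hirr`): over the field `R_⊥ = Frac R` the radicand ring `R_⊥[X]/(X² − f)` is regular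
(`X² − f` has no root; transversality criterion with `𝔪 = ⊥`). Stated for a prime `Q = ⊥` to avoid transporting
instances. [folklore] -/
theorem isRegularLocalRing_radicand_of_eq_bot (R : Subring K) [IsRegularLocalRing R] (s : K) (hs : s ^ 2 ∈ R)
    (hirr : ∀ y z : R, (z : K) ≠ 0 → s * z ≠ y) (Q : Ideal R) [Q.IsPrime] (hQ : Q = ⊥) :
    IsRegularLocalRing (AdjoinRoot ((X : (Localization.AtPrime Q)[X]) ^ 2 -
      C (algebraMap R (Localization.AtPrime Q) ⟨s ^ 2, hs⟩))) := by
  classical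
  haveI := isDomain_of_isRegularLocalRing R
  set D := Localization.AtPrime Q with hD
  haveI : IsRegularLocalRing D := isRegularLocalRing_localization_atPrime R Q
  have hinj : Function.Injective (algebraMap R D) := IsLocalization.injective D Q.primeCompl_le_nonZeroDivisors
  haveI : CharP D 2 := charP_of_injective_algebraMap hinj 2
  haveI : Fact (Nat.Prime 2) := ⟨Nat.prime_two⟩
  have hmax : maximalIdeal D = ⊥ := by
    rw [← Localization.AtPrime.map_eq_maximalIdeal, Ideal.map_eq_bot_iff_le_ker]
    intro x hx
    have hx0 : x = 0 := by rwa [hQ, Ideal.mem_bot] at hx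
    rw [hx0]; exact Ideal.zero_mem _
  refine EmptyStallTwo.isRegularLocalRing_adjoinRoot_X_pow_sub_C_of_forall_not_mem_sq 2 _ fun g' hg' => ?_
  rw [hmax, Ideal.bot_pow (by norm_num), Ideal.mem_bot, sub_eq_zero] at hg'
  obtain ⟨⟨y, z⟩, hyz⟩ := IsLocalization.mk'_surjective Q.primeCompl g'
  have hyz' : IsLocalization.mk' D y z = g' := hyz
  rw [← hyz'] at hg'
  -- `f · z² = y²` in `R`, hence `(s z)² = y²` in `K` and `s z = y` (characteristic two)
  have hz0 : ((z : R) : K) ≠ 0 := by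
    intro e
    have : (z : R) = 0 := Subtype.ext e
    exact z.2 (by rw [this, hQ]; exact Submodule.zero_mem ⊥)
  have hR : (⟨s ^ 2, hs⟩ : R) * (z : R) ^ 2 = y ^ 2 := by
    apply hinj
    rw [map_mul, map_pow, map_pow, hg', ← mul_pow, mul_comm, IsLocalization.mk'_spec' D y z]
  have hK : (s * (z : R)) ^ 2 = ((y : R) : K) ^ 2 := by
    have := congrArg (fun w : R => (w : K)) hR
    simpa [mul_pow] using this
  have hK' : s * ((z : R) : K) = (y : R) := by
    have h0 : (s * ((z : R) : K) - (y : R)) ^ 2 = 0 := by rw [← sq_sub_sq_eq, hK, sub_self]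
    exact sub_eq_zero.mp (pow_eq_zero_iff two_ne_zero |>.mp h0)
  exact hirr y z hz0 hK'

end Generic

/-! ## (4) (α) permissibility of the regular carrier `(u)`, `u ∉ 𝔪²` -/

section Permissible

variable {K : Type u} [Field K] [CharP K 2]

omit [CharP K 2] in
/-- Dimension bookkeeping: the maximal ideal of a four-dimensional local ring has height `4`. [folklore] -/
theorem height_maximalIdeal_eq_four (R : Subring K) [IsRegularLocalRing R] (hdim : ringKrullDim R = 4) :
    (maximalIdeal R).height = 4 := by
  have h0 : ((maximalIdeal R).height : WithBot ℕ∞) = ((4 : ℕ∞) : WithBot ℕ∞) := by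
    rw [IsLocalRing.maximalIdeal_height_eq_ringKrullDim, hdim]; norm_cast
  exact WithBot.coe_eq_coe.mp h0

/-- **(α) the regular height-one carrier is σ_top-permissible.** `R ⊆ K` regular local of dimension four
(characteristic two), `f = s²` with `s ∉ Frac R` (`hirr`), `u ∈ 𝔪 ∖ 𝔪²` prime with `(u)` a singular prime of the
radicand and `f − g² ∈ (u)²`. Then `(u)` satisfies the skeleton's `IsPermissibleCentre R 2 f (u)` UNFOLDED:
`(u) ≠ 𝔪`; `(u)` is a top singular component (singular; minimal among singular primes since only `⊥ < (u)` and `⊥` is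
not singular; of maximal dimension `dim R/(u) = 3 ≥ dim R/Q''` for every singular `Q'' ≠ ⊥`); `R/(u)` is regular;
and `f` is equimultiple along `(u)` after cleaning. [cite: Matsumura1987, Thm. 14.2] [folklore] -/
theorem permissible_span_singleton_of_not_mem_sq (R : Subring K) [IsRegularLocalRing R] (hdim : ringKrullDim R = 4)
    (s : K) (hs : s ^ 2 ∈ R) (hirr : ∀ y z : R, (z : K) ≠ 0 → s * z ≠ y)
    {u : R} (hum : u ∈ maximalIdeal R) (hu2 : u ∉ maximalIdeal R ^ 2)
    [(Ideal.span {u}).IsPrime]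
    (hsing : ¬ IsRegularLocalRing (AdjoinRoot ((X : (Localization.AtPrime (Ideal.span {u}))[X]) ^ 2 -
      C (algebraMap R (Localization.AtPrime (Ideal.span {u})) ⟨s ^ 2, hs⟩))))
    (hg : ∃ g : R, (⟨s ^ 2, hs⟩ : R) - g ^ 2 ∈ Ideal.span {u} ^ 2) :
    Ideal.span {u} ≠ maximalIdeal R ∧
    (∃ _ : (Ideal.span {u}).IsPrime,
      (¬ IsRegularLocalRing (AdjoinRoot ((X : (Localization.AtPrime (Ideal.span {u}))[X]) ^ 2 -
        C (algebraMap R (Localization.AtPrime (Ideal.span {u})) ⟨s ^ 2, hs⟩)))) ∧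
      (∀ (Q : Ideal R) [Q.IsPrime],
        (¬ IsRegularLocalRing (AdjoinRoot ((X : (Localization.AtPrime Q)[X]) ^ 2 -
          C (algebraMap R (Localization.AtPrime Q) ⟨s ^ 2, hs⟩)))) →
        Q ≤ Ideal.span {u} → Q = Ideal.span {u}) ∧
      (∀ (Q : Ideal R) [Q.IsPrime],
        (¬ IsRegularLocalRing (AdjoinRoot ((X : (Localization.AtPrime Q)[X]) ^ 2 -
          C (algebraMap R (Localization.AtPrime Q) ⟨s ^ 2, hs⟩)))) →
        (∀ (Q' : Ideal R) [Q'.IsPrime],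
          (¬ IsRegularLocalRing (AdjoinRoot ((X : (Localization.AtPrime Q')[X]) ^ 2 -
            C (algebraMap R (Localization.AtPrime Q') ⟨s ^ 2, hs⟩)))) → Q' ≤ Q → Q' = Q) →
        ringKrullDim (R ⧸ Q) ≤ ringKrullDim (R ⧸ Ideal.span {u}))) ∧
    IsRegularLocalRing (R ⧸ Ideal.span {u}) ∧
    ∃ g : R, (⟨s ^ 2, hs⟩ : R) - g ^ 2 ∈ Ideal.span {u} ^ 2 := by
  classical
  haveI := isDomain_of_isRegularLocalRing R
  have hquot := IsRegularLocalRing.quotient_span_singleton hum hu2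
  have hm4 := height_maximalIdeal_eq_four R hdim
  -- height of `(u)` is at most one
  have hunit : ¬ IsUnit u := fun h => (IsLocalRing.mem_maximalIdeal u).mp hum h
  have hh1 : (Ideal.span {u}).height ≤ 1 := Ideal.height_span_singleton_le_one hunit
  -- the generic point is not singular
  have hbot : ∀ (Q : Ideal R) [Q.IsPrime], Q = ⊥ →
      IsRegularLocalRing (AdjoinRoot ((X : (Localization.AtPrime Q)[X]) ^ 2 -
        C (algebraMap R (Localization.AtPrime Q) ⟨s ^ 2, hs⟩))) :=
    fun Q _ hQ => isRegularLocalRing_radicand_of_eq_bot R s hs hirr Q hQ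
  -- dimension of `R/(u)` is three, and `dim R/Q'' ≤ 3` for every non-zero `Q''`
  haveI : IsLocalRing (R ⧸ Ideal.span {u}) := isLocalRing_quotient (Ideal.span_singleton_ne_top hunit)
  obtain ⟨nb, hnb⟩ := exists_nat_cast_eq_ringKrullDim (R := R ⧸ Ideal.span {u})
  have hnb3 : nb = 3 := by
    have e := hquot.2
    rw [hnb, hdim] at e
    have e' : ((nb : WithBot ℕ∞) + 1) = ((nb + 1 : ℕ) : WithBot ℕ∞) := by push_cast; rfl
    rw [e'] at e
    have : nb + 1 = 4 := by exact_mod_cast e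
    omega
  refine ⟨?_, ⟨inferInstance, hsing, ?_, ?_⟩, hquot.1, hg⟩
  · -- `(u) ≠ 𝔪`: heights `≤ 1` versus `4`
    intro e
    rw [e, hm4] at hh1
    exact absurd hh1 (by decide)
  · -- minimality among singular primes: below `(u)` there is only `⊥`, which is not singular
    intro Q _ hQsing hQle
    by_contra hne
    have hlt : Q < Ideal.span {u} := lt_of_le_of_ne hQle hne
    have hQh : Q.height < (Ideal.span {u}).height := Ideal.height_strict_mono_of_isPrime hlt
    have hQ0 : Q.height = 0 := by
      have : Q.height < 1 := lt_of_lt_of_le hQh hh1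
      exact Order.lt_one_iff.mp this
    exact hQsing (hbot Q ((Ideal.height_eq_zero_iff_eq_bot).mp hQ0))
  · -- top-dimensionality
    intro Q _ hQsing _
    have hQ0 : Q ≠ ⊥ := fun e => hQsing (hbot Q e)
    obtain ⟨r, hrQ, hr0⟩ := Submodule.exists_mem_ne_zero_of_ne_bot hQ0
    have hrnzd : r ∈ nonZeroDivisors R := mem_nonZeroDivisors_of_ne_zero hr0
    have hle1 : ringKrullDim (R ⧸ Q) ≤ ringKrullDim (R ⧸ Ideal.span {r}) :=
      ringKrullDim_le_of_surjective (Ideal.Quotient.factor ((Ideal.span_singleton_le_iff_mem _).mpr hrQ))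
        (Ideal.Quotient.factor_surjective _)
    have hle2 := ringKrullDim_quotient_succ_le_of_nonZeroDivisor hrnzd
    have hrm : r ∈ maximalIdeal R := le_maximalIdeal (Ideal.IsPrime.ne_top inferInstance) hrQ
    haveI : IsLocalRing (R ⧸ Ideal.span {r}) :=
      isLocalRing_quotient (Ideal.span_singleton_ne_top ((IsLocalRing.mem_maximalIdeal r).mp hrm))
    obtain ⟨na, hna⟩ := exists_nat_cast_eq_ringKrullDim (R := R ⧸ Ideal.span {r})
    rw [hna, hdim] at hle2
    have hna3 : na ≤ 3 := by
      have e' : ((na + 1 : ℕ) : WithBot ℕ∞) ≤ ((4 : ℕ) : WithBot ℕ∞) := by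
        have : ((na : WithBot ℕ∞) + 1) = ((na + 1 : ℕ) : WithBot ℕ∞) := by push_cast; rfl
        rw [← this]; exact hle2
      have : na + 1 ≤ 4 := by exact_mod_cast e'
      omega
    calc ringKrullDim (R ⧸ Q) ≤ ringKrullDim (R ⧸ Ideal.span {r}) := hle1
      _ = na := hna
      _ ≤ (nb : WithBot ℕ∞) := by exact_mod_cast (hnb3 ▸ hna3)
      _ = ringKrullDim (R ⧸ Ideal.span {u}) := hnb.symm

end Permissible

/-! ## (5) B4 reduced to the deep case `u ∈ 𝔪²` -/

section Main

variable {K : Type u} [Field K] [CharP K 2]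

/-- **B4, reduction to the deep carrier.** `R ⊆ K` regular local of dimension four (characteristic two), radicand
`f = s²` with `s ∉ Frac R` (`hirr`), and NO positive-dimensional σ_top-permissible centre (`hnoperm`: the skeleton's
`∀ P, ¬ IsPermissibleCentre R 2 f P` UNFOLDED — the content of a point step, `IsPointStep` + `IsSigmaTopCentre`). Then
every singular HEIGHT-ONE prime `Q` of `f` is `Q = (u)` with `u ∈ 𝔪²` (a carrier singular at the closed point) and
carries a LOCAL square root: `d² f − a² ∈ Q²`, `d ∉ Q`. (The regular case `u ∉ 𝔪²` is excluded by
`permissible_span_singleton_of_not_mem_sq`.) The sequel turns this into `f − ĝ² ∈ 𝔪⁴` (order raising in the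
completion), where B1 `divisorTrigger_two` forbids the point step at the next stage. [cite: Matsumura1987, Thm. 14.2]
[folklore] -/
theorem exists_deep_witness_of_singular_heightOne (R : Subring K) [IsRegularLocalRing R] (hdim : ringKrullDim R = 4)
    (s : K) (hs : s ^ 2 ∈ R) (hirr : ∀ y z : R, (z : K) ≠ 0 → s * z ≠ y)
    (hnoperm : ∀ P : Ideal R, ¬ (P ≠ maximalIdeal R ∧
      (∃ _ : P.IsPrime,
        (¬ IsRegularLocalRing (AdjoinRoot ((X : (Localization.AtPrime P)[X]) ^ 2 -
          C (algebraMap R (Localization.AtPrime P) ⟨s ^ 2, hs⟩)))) ∧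
        (∀ (Q : Ideal R) [Q.IsPrime],
          (¬ IsRegularLocalRing (AdjoinRoot ((X : (Localization.AtPrime Q)[X]) ^ 2 -
            C (algebraMap R (Localization.AtPrime Q) ⟨s ^ 2, hs⟩)))) →
          Q ≤ P → Q = P) ∧
        (∀ (Q : Ideal R) [Q.IsPrime],
          (¬ IsRegularLocalRing (AdjoinRoot ((X : (Localization.AtPrime Q)[X]) ^ 2 -
            C (algebraMap R (Localization.AtPrime Q) ⟨s ^ 2, hs⟩)))) →
          (∀ (Q' : Ideal R) [Q'.IsPrime],
            (¬ IsRegularLocalRing (AdjoinRoot ((X : (Localization.AtPrime Q')[X]) ^ 2 -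
              C (algebraMap R (Localization.AtPrime Q') ⟨s ^ 2, hs⟩)))) → Q' ≤ Q → Q' = Q) →
          ringKrullDim (R ⧸ Q) ≤ ringKrullDim (R ⧸ P))) ∧
      IsRegularLocalRing (R ⧸ P) ∧ ∃ g : R, (⟨s ^ 2, hs⟩ : R) - g ^ 2 ∈ P ^ 2))
    (Q : Ideal R) [Q.IsPrime] (hQ : Q.height = 1)
    (hsing : ¬ IsRegularLocalRing (AdjoinRoot ((X : (Localization.AtPrime Q)[X]) ^ 2 -
      C (algebraMap R (Localization.AtPrime Q) ⟨s ^ 2, hs⟩)))) :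
    ∃ u a d : R, Q = Ideal.span {u} ∧ Prime u ∧ u ∈ maximalIdeal R ^ 2 ∧ d ∉ Q ∧
      d ^ 2 * (⟨s ^ 2, hs⟩ : R) - a ^ 2 ∈ Q ^ 2 := by
  classical
  haveI := isDomain_of_isRegularLocalRing R
  obtain ⟨u, hQu, hu⟩ := exists_eq_span_singleton_of_height_eq_one R Q hQ
  obtain ⟨a, d, hd, had⟩ := exists_witness_of_singular R ⟨s ^ 2, hs⟩ Q hsing
  by_cases hu2 : u ∈ maximalIdeal R ^ 2
  · exact ⟨u, a, d, hQu, hu, hu2, hd, had⟩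
  exfalso
  subst hQu
  have hum : u ∈ maximalIdeal R :=
    le_maximalIdeal (Ideal.IsPrime.ne_top inferInstance) (Ideal.mem_span_singleton_self u)
  have hg := exists_sub_sq_mem_span_sq_of_not_mem_sq R hu hum hu2 hd had
  obtain ⟨hne, ⟨_, h1, h2, h3⟩, hregq, hg'⟩ := permissible_span_singleton_of_not_mem_sq R hdim s hs hirr hum hu2 hsing hg
  refine hnoperm (Ideal.span {u}) ⟨hne, ⟨inferInstance, ?_, ?_, ?_⟩, hregq, hg'⟩
  · exact h1
  · exact h2
  · exact h3

end Main

end NoHeightOneCarrier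

end Summit.ResolutionOfSingularities.ResolutionOfSingularities.Theorems.SwitchingDichotomy

end
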